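import Mathlib
import Literature.LinearAlgebra.Matrix.GerstenhaberNilpotentSubspace
import Summits.ValiantsHypothesis.ValiantsHypothesis.Theorems.GrenetZeonTwoDimCoefficientsDualUnipotentSmallWidth

/-!
# Crux `GrenetZeon.TwoDimCoefficients` (stmt-ValiantsHypothesis-8062), stub `stub_dualUnipotent`:
# Gerstenhaber's theorem in the unipotent-trace model

The line card of `dim2_cases` lists Gerstenhaber's theorem (a linear space of nilpotent `m × m`
matrices has dimension `≤ m(m−1)/2`) as a candidate tool for the open stub `stub_dualUnipotent`
(`DualUnipotentBound`).  With the inequality now in the tree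
(`Literature.LinearAlgebra.Matrix.GerstenhaberNilpotentSubspace.finrank_le_choose_two`,
after de Seguins Pazzis 2013) this file records exactly what it buys:

* `gerstenhaber_bound_of_dualUnipotentRepr` — `DualUnipotentRepr n m`, `n ≥ 3` ⟹
  `n² ≤ binom(m,2) + ⌊n²/2⌋`.  In the nilpotent-pencil normal form `per_n = tr(N^{n−1} M)` the
  values `N(u)` (`u ∈ ℂ^{n×n}`) form a linear space of NILPOTENT matrices (dimension
  `≤ binom(m,2)`, Gerstenhaber — replacing the trace-isotropy count `≤ m²/2` of
  `sq_le_of_dualUnipotentRepr_isotropy`), whose common kernel is a second-order flat of `per_n`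
  (dimension `≤ ⌊n²/2⌋` by `two_mul_finrank_le_sq_of_hess0_perPoly_isOrtho`); rank–nullity.
  (With the flat bound `≤ 2n` of `…PermanentHessianFlat.lean` one gets `n² ≤ binom(m,2) + 2n`,
  i.e. `2n² ≤ m(m−1) + 4n`; not imported here while that module's farm build is pending.)
* `sq_le_mul_pred_of_dualUnipotentRepr` — the packaged form `n² ≤ m(m−1)`.
* `not_dualUnipotentRepr_four_four` — `¬ DualUnipotentRepr 4 4` (`16 ≤ 6 + 8` fails): the
  unipotent-trace width of `per_4` is `≥ 5` (at `n = 3` the bound re-derives `m ≥ 4`,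
  `not_dualUnipotentRepr_three_three`).

HONEST FRAMING: constant-factor bookkeeping inside the quadratic regime, far below the stub's claim
`n² ≤ C·m` and inside the Hessian-profile barrier of `…DualUnipotentProfileBlind.lean`; the stub
stays open; `VP ≠ VNP` is not moved by anything here.

References: C. de Seguins Pazzis, Linear Algebra Appl. 438 (2013) 4426–4438 (Gerstenhaber's
theorem); M. Gerstenhaber, Amer. J. Math. 80 (1958) 614–622; T. Mignon, N. Ressayre, Int. Math.
Res. Not. 2004:79.
-/

-- single-conjunct layout `Summits/ValiantsHypothesis/ValiantsHypothesis`: the duplicated namespace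
-- component is mandated by the tree.
set_option linter.dupNamespace false

noncomputable section

namespace Summit.ValiantsHypothesis.ValiantsHypothesis.Cruxes.TwoDimCoefficients.DimTwoCases

open MvPolynomial Matrix
open Literature.Computability.AlgebraicComplexity
open Literature.LinearAlgebra.Matrix.GerstenhaberNilpotentSubspace

/-! ### Euler: the directional derivative of a linear form is its value -/

section Euler

variable {σ : Type*} [Fintype σ]

/-- For a linear form `f`, `(∂_u f)(0) = f(u)` (Euler's identity in degree one). [folklore] -/
theorem constantCoeff_sum_smul_pderiv_eq_eval (u : σ → ℂ) {f : MvPolynomial σ ℂ}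
    (hf : f.IsHomogeneous 1) :
    constantCoeff ((∑ s, u s • (pderiv s : Derivation ℂ (MvPolynomial σ ℂ) (MvPolynomial σ ℂ))) f)
      = eval u f := by
  have hE := hf.sum_X_mul_pderiv
  rw [one_smul] at hE
  have hc : ∀ s, pderiv s f = C (constantCoeff (pderiv s f)) := fun s =>
    eq_C_of_isHomogeneous_zero
      (by simpa using Literature.Algebra.Polynomial.JacobianCriterion.isHomogeneous_pderiv hf s)
  conv_rhs => rw [← hE]
  rw [sum_smul_pderiv_apply, map_sum, map_sum]
  refine Finset.sum_congr rfl fun s _ => ?_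
  rw [constantCoeff_smul, smul_eq_mul, map_mul, eval_X, hc s, constantCoeff_C, eval_C]

end Euler

/-! ### The bound -/

section Bound

/-- **Gerstenhaber's theorem in the unipotent-trace model.** If `per_n` (`n ≥ 3`) has a unipotent
dual representation of size `m`, then `n² ≤ binom(m,2) + ⌊n²/2⌋`: the values of the nilpotent
pencil form a nilpotent linear space (`dim ≤ binom(m,2)`), its common kernel is a second-order flat
of the permanent (`2·dim ≤ n²`). [folklore] -/
theorem gerstenhaber_bound_of_dualUnipotentRepr {n m : ℕ} (hn : 3 ≤ n)
    (h : DualUnipotentRepr n m) : n ^ 2 ≤ m.choose 2 + n ^ 2 / 2 := by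
  obtain ⟨N, M, hN, hM, hNil, hper⟩ := exists_nilpotent_pencil_of_dualUnipotentRepr (by omega) h
  -- the derivative of the pencil, as a linear map
  let D : (Fin n × Fin n → ℂ) → Derivation ℂ (MvPolynomial (Fin n × Fin n) ℂ)
      (MvPolynomial (Fin n × Fin n) ℂ) := fun u => ∑ s, u s • (pderiv s : Derivation ℂ
        (MvPolynomial (Fin n × Fin n) ℂ) (MvPolynomial (Fin n × Fin n) ℂ))
  have hDadd : ∀ u v, D (u + v) = D u + D v := fun u v => by
    simp only [D, Pi.add_apply, add_smul, Finset.sum_add_distrib]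
  have hDsmul : ∀ (c : ℂ) u, D (c • u) = c • D u := fun c u => by
    simp only [D, Pi.smul_apply, smul_eq_mul, mul_smul, Finset.smul_sum]
  let Φ : (Fin n × Fin n → ℂ) →ₗ[ℂ] Matrix (Fin m) (Fin m) ℂ :=
    { toFun := fun u => N.map fun f => constantCoeff (D u f)
      map_add' := fun u v => by
        ext i j
        simp only [Matrix.map_apply, Matrix.add_apply, hDadd, Derivation.add_apply, map_add]
      map_smul' := fun c u => by
        ext i j
        simp only [Matrix.map_apply, Matrix.smul_apply, hDsmul, Derivation.smul_apply,
          RingHom.id_apply, smul_eq_mul, constantCoeff_smul] }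
  have hΦ : ∀ u, Φ u = N.map fun f => constantCoeff (D u f) := fun u => rfl
  have hD0 : ∀ u (f : MvPolynomial (Fin n × Fin n) ℂ), f.IsHomogeneous 1 →
      (D u f).IsHomogeneous 0 := fun u f hf => isHomogeneous_zero_sum_smul_pderiv u hf
  -- the values of the pencil: `Φ u = N(u)` is nilpotent
  have hΦeval : ∀ u, Φ u = N.map (eval u) := by
    intro u
    rw [hΦ]
    ext i j
    rw [Matrix.map_apply, Matrix.map_apply]
    exact constantCoeff_sum_smul_pderiv_eq_eval u (hN i j)
  have hrange : Module.finrank ℂ (LinearMap.range Φ) ≤ m.choose 2 := by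
    refine finrank_le_choose_two m _ ?_
    rintro B ⟨u, rfl⟩
    refine ⟨m, ?_⟩
    rw [hΦeval, ← RingHom.mapMatrix_apply, ← map_pow, hNil, map_zero]
  -- kernel: a second-order flat of the permanent
  have hflat : ∀ p : Fin n × Fin n → ℂ, ∀ u ∈ LinearMap.ker Φ, ∀ v ∈ LinearMap.ker Φ,
      Matrix.toBilin' (hess0 (transl p (perPoly (Fin n) ℂ))) u v = 0 := by
    intro p u hu v hv
    have hu' : N.map (D u) = 0 := by
      rw [map_derivation_eq_map_C (D u) (hD0 u) hN, ← hΦ, LinearMap.mem_ker.1 hu]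
      exact Matrix.map_zero _ (map_zero (algebraMap ℂ (MvPolynomial (Fin n × Fin n) ℂ)))
    have hv' : N.map (D v) = 0 := by
      rw [map_derivation_eq_map_C (D v) (hD0 v) hN, ← hΦ, LinearMap.mem_ker.1 hv]
      exact Matrix.map_zero _ (map_zero (algebraMap ℂ (MvPolynomial (Fin n × Fin n) ℂ)))
    rw [toBilin'_hess0_transl_eq_eval p u v (perPoly (Fin n) ℂ), hper,
      derivation_derivation_trace_pow_mul hM (n - 1) (D v) (D u) (hD0 v) hv' hu', map_zero]
  have hker₁ : 2 * Module.finrank ℂ (LinearMap.ker Φ) ≤ n ^ 2 :=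
    two_mul_finrank_le_sq_of_hess0_perPoly_isOrtho hn _ hflat
  -- rank–nullity
  have hsum : Module.finrank ℂ (LinearMap.range Φ) + Module.finrank ℂ (LinearMap.ker Φ) = n ^ 2 := by
    rw [LinearMap.finrank_range_add_finrank_ker Φ, Module.finrank_fintype_fun_eq_card,
      Fintype.card_prod, Fintype.card_fin, sq]
  have h2 : Module.finrank ℂ (LinearMap.ker Φ) ≤ n ^ 2 / 2 :=
    (Nat.le_div_iff_mul_le two_pos).2 (by omega)
  omega

/-- **Packaged form:** a unipotent dual representation of `per_n` (`n ≥ 3`) of size `m` forces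
`n² ≤ m(m−1)` (`⌈n²/2⌉ ≤ binom(m,2)`). [folklore] -/
theorem sq_le_mul_pred_of_dualUnipotentRepr {n m : ℕ} (hn : 3 ≤ n)
    (h : DualUnipotentRepr n m) : n ^ 2 ≤ m * (m - 1) := by
  have h1 := gerstenhaber_bound_of_dualUnipotentRepr hn h
  have h2 : m.choose 2 = m * (m - 1) / 2 := Nat.choose_two_right m
  have h3 : m * (m - 1) / 2 * 2 ≤ m * (m - 1) := Nat.div_mul_le_self _ _
  have h4 : n ^ 2 / 2 * 2 ≤ n ^ 2 := Nat.div_mul_le_self _ _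
  omega

/-- **The permanent of order `4` has no unipotent dual representation of size `4`**
(`16 ≤ binom(4,2) + 8 = 14` fails): the unipotent-trace width of `per_4` is `≥ 5`. [folklore] -/
theorem not_dualUnipotentRepr_four_four : ¬ DualUnipotentRepr 4 4 := by
  intro h
  have := gerstenhaber_bound_of_dualUnipotentRepr (by norm_num) h
  simp [Nat.choose] at this

end Bound

end Summit.ValiantsHypothesis.ValiantsHypothesis.Cruxes.TwoDimCoefficients.DimTwoCases

end
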